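import Literature.NumberTheory.EllipticCurves.Kim2025.MainIdentityAtAugmentationFineDictionary
import HarnessLib

/-!
# C.-H. Kim, arXiv:2505.09121v1, Thm. 3.18 (1) (= Kato 2004 Thm. 12.5 (4) with (17.13.1)) for an
# elliptic curve at a good ordinary prime: the one-sided divisibility of the FINE main conjecture,
# `char_Λ(𝐇¹_Γ(T_pW)/Z(f,T)) ⊆ char_Λ(X₀(E/ℚ_∞))`, PROVED over Kato's §17.13 package (theorems only)

Topic `NumberTheory/EllipticCurves`, sub-directory `Kim2025`; namespace
`Literature.NumberTheory.EllipticCurves.Kim2025`.  Typing layer (cell `bsd-littype`, seat 09, gen 4);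
companion of `MainIdentityAtAugmentationFineDictionary` (same package, same fine quotient).  HONEST
FRAMING: THEOREMS ONLY (0 definitions, 0 named facts); nothing about any curve is asserted beyond what
the named construction fact `Kato2004.exists_divisibilityInputs_fineQuotient` and `Kato2004.thm12_4`
already carry; BSD is not advanced.

The printed statements.
* C.-H. Kim, arXiv:2505.09121v1, **Thm. 3.18 (Kato, Mazur–Rubin) (1)** (§3.5.3, held text
  `paper:arxiv-2505.09121` chunk p0014:L53–L59): "Assume that `ρ_f` has large image. Let
  `κ^{Kato,k−r,∞} ∈ KS(T_f(k−r) ⊗ Λ)` be the `Λ`-adic Kato's Kolyvagin system for `T_f(k−r)`.  The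
  one-sided divisibility of the Iwasawa main conjecture holds
  `char_Λ( H¹_Iw(ℚ, T_f(k−r)) / Λκ^{Kato,k−r,∞}_1 ) ⊆ char_Λ( Sel₀(ℚ_∞, W_f̄(r))^∨ )`."
* K. Kato, Astérisque 295 (2004), **Thm. 12.5 (4)** (p. 222, held text `paper:url-37fbba0bb64a`
  p0107:L10–L20): "Let `T` be a `Gal(ℚ̄/ℚ)`-stable `O_λ`-lattice of `V_{F_λ}(f)`, and let `Z(f,T)` be
  the `Λ`-submodule of `𝐇¹(T) ⊗ ℚ` generated by `z_γ^{(p)}` for all `γ ∈ T`.  Assume `p ≠ 2`, and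
  assume (12.5.2) [the image of `Gal(ℚ̄/ℚ(ζ_{p^∞}))` in `GL_{O_λ}(T)` contains `SL₂(ℤ_p)`].  Then
  `Z(f,T) ⊂ 𝐇¹(T)`.  Furthermore `length_{Λ_𝔭}(𝐇²(T)_𝔭) ≤ length_{Λ_𝔭}(𝐇¹(T)_𝔭/Z(f,T)_𝔭)` for any
  prime ideal `𝔭` of `Λ` of height one unless `f` and `𝔭` satisfy (12.5.1)"; with **(17.13.1)**
  (p. 279, p0164:L18–L29) `… → 𝔛 → 𝐇²(T) → 𝐇²_loc(T)`, whose cokernel at `𝔛` is the dual fine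
  Selmer group (`Kato2004/DivisibilityInputsFine.lean`), so that `X₀ ↪ 𝐇²` and
  `length(X₀)_𝔭 ≤ length(𝐇²)_𝔭`.

What the tree already holds.  The §17.13 package `K : Kato2004.DivisibilityInputs W p f κ γ I D`
(good ORDINARY odd `p`) carries Thm. 12.5 (4) VERBATIM as its field `integral`: under tower
surjectivity `ρ̄_{E,p^m}` onto for all `m` (which implies (12.5.2); (12.5.1) is excluded by good
reduction), there are the integral zeta submodule `Z' = Z(f,T)_Γ ≤ 𝐇¹_Γ(T_pW)` and `G' ∈ col(loc Z')`
with `ι G' = L_p(E,T)` and `length(𝐇²)_𝔭 ≤ length(𝐇¹/Z')_𝔭` at EVERY height-one `𝔭`; and the fine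
quotient `π : X(E/ℚ_∞) ↠ Y` exact after `P → X` (named fact `exists_divisibilityInputs_fineQuotient`,
`Y = X₀(E/ℚ_∞)`).  This file composes them (pure module theory):

* `lengthAt_fine_le_lengthAt_H2` — `ℓ_𝔭(Y) ≤ ℓ_𝔭(𝐇²)` at every prime (`Y ≅ Ker ε ⊆ 𝐇²`);
* `exists_integralZeta_lengthAt_fine_le` — **Thm. 3.18 (1) / 12.5 (4) in length form for `X₀`**:
  `∃ Z' G', G' ∈ col(loc Z') ∧ ι G' = L_p ∧ ∀ 𝔭 (height one), ℓ_𝔭(Y) ≤ ℓ_𝔭(𝐇¹_Γ/Z')`;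
* `charIdeal_le_charIdeal_of_lengthAt_le` — over `Λ`, for finitely generated torsion modules,
  pointwise `ℓ_𝔭(N) ≤ ℓ_𝔭(M)` at the height-one primes gives `char(M) ⊆ char(N)` (Washington §13.2;
  the converse of the tree's `SkinnerUrban2014.lengthAt_le_of_charIdeal_le`);
* `exists_integralZeta_charIdeal_le_charIdeal_fine` — **Thm. 3.18 (1) as printed (ideal form), for
  `E` at a good ordinary odd `p` under tower surjectivity**: `char_Λ(𝐇¹_Γ/Z') ⊆ char_Λ(Y)`, with
  `𝐇¹_Γ` finitely generated, torsion free of rank one by the named fact `Kato2004.thm12_4`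
  (Thm. 12.4 (2)), `𝐇¹_Γ/Z'` torsion because `L_p ≠ 0` (Rohrlich, tree theorem) lies in `col(loc Z')`;
* the `FineSelmerDualData` instance `exists_charIdeal_le_charIdeal_fineSelmerDual_of_facts`, consuming
  `exists_divisibilityInputs_fineQuotient` and `thm12_4` BY NAME.

READING of `Z'` as Kim's `Λκ^{Kato,∞}_1`: as in the companion file (Thm. 12.5 (4) `Z(f,T)` =
`Λ z_{γ⁺} + Λ z_{γ⁻}` = `Λ z_γ`, `γ = γ⁺ + γ⁻`, Def. 3.2 / Thm. 12.5 (1); projected to the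
`Δ`-trivial component) — a reading of print; the package pins `Z'` only by its printed properties.
Scope: weight `2`, trivial character, good ORDINARY `p ≥ 3` (print: any `p ≥ 3` with large image —
the non-ordinary case has no tree carrier, OPEN-QUESTIONS-09 Q12); WEAKER than print, never stronger.

## References
* C.-H. Kim (app. with R. Pollack), arXiv:2505.09121v1 (2025), Thm. 3.18 (1), Def. 3.2. [Kim2025RefinedTNC]
* K. Kato, Astérisque 295 (2004), Thm. 12.4 (2) (p. 221), Thm. 12.5 (1), (4) (pp. 221–222),
  Thm. 12.6 (p. 222), §17.13 (17.13.1)–(17.13.4) (p. 279), p. 280. [Kato2004Asterisque]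
* B. Mazur, K. Rubin, *Kolyvagin systems*, Mem. AMS 799 (2004), Thm. 5.3.10. [MazurRubin2004]
* L. Washington, *Introduction to Cyclotomic Fields*, §13.2. [Washington1997]
-/

noncomputable section

open scoped MatrixGroups ModularForm Classical

open CongruenceSubgroup Literature.NumberTheory.EllipticCurves.ModularForms
  Literature.NumberTheory.EllipticCurves Literature.NumberTheory.EllipticCurves.Module
  Literature.NumberTheory.EllipticCurves.IwasawaAlgebra
open Field Literature.NumberTheory.GaloisRepresentations
open Literature.NumberTheory.EllipticCurves.Kato2004
open Literature.NumberTheory.EllipticCurves.Kato2004.EulerSystemValues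

universe u v

namespace Literature.NumberTheory.EllipticCurves.Kim2025

/-! ### `Λ`-algebra: pointwise length inequalities give an inclusion of characteristic ideals -/

section Algebra

variable {p : ℕ} [Fact p.Prime]
  {M : Type u} [AddCommGroup M] [_root_.Module (IwasawaAlgebra p) M]
  [Module.Finite (IwasawaAlgebra p) M]
  {N : Type v} [AddCommGroup N] [_root_.Module (IwasawaAlgebra p) N]
  [Module.Finite (IwasawaAlgebra p) N]

/-- **`ℓ_𝔭(N) ≤ ℓ_𝔭(M)` at every height-one `𝔭` ⟹ `char_Λ(M) ⊆ char_Λ(N)`** for finitely generated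
torsion `Λ`-modules (`char = ∏ 𝔭^{ℓ_𝔭}`, Washington §13.2): write `char(M) = (g)`, `g ≠ 0` a product of
prime powers; `ℓ_𝔭(Λ/(g)) = ℓ_𝔭(M)` (the characteristic ideal determines the height-one lengths,
`SkinnerUrban2014.lengthAt_eq_of_charIdeal_eq`); so `ℓ_𝔭(N) ≤ ℓ_𝔭(Λ/(g))` everywhere and
`g ∈ char(N)` (`Module.mem_charIdeal_of_lengthAt_le`). [cite: Washington1997, §13.2]
[cite: SkinnerUrban2014, §3.1.6 (p. 20)] -/
theorem charIdeal_le_charIdeal_of_lengthAt_le (hM : Module.IsTorsion (IwasawaAlgebra p) M)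
    (hN : Module.IsTorsion (IwasawaAlgebra p) N)
    (h : ∀ 𝔭 : PrimeSpectrum (IwasawaAlgebra p), 𝔭.asIdeal.height = 1 →
      lengthAt (IwasawaAlgebra p) N 𝔭 ≤ lengthAt (IwasawaAlgebra p) M 𝔭) :
    charIdeal (IwasawaAlgebra p) M ≤ charIdeal (IwasawaAlgebra p) N := by
  obtain ⟨t, π, ht, -, -, hchar⟩ := SkinnerUrban2014.exists_charIdeal_eq_span_prod (M := M) hM
  set g : IwasawaAlgebra p := ∏ 𝔮 ∈ t, π 𝔮 ^ (lengthAt (IwasawaAlgebra p) M 𝔮).toNat with hg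
  have hg0 : g ≠ 0 :=
    Finset.prod_ne_zero_iff.mpr fun 𝔮 h𝔮 ↦ pow_ne_zero _ (ht 𝔮 h𝔮).2.1.ne_zero
  -- `Λ/(g)` is finitely generated torsion with `char = (g) = char M`
  have hby : Module.IsTorsionBy (IwasawaAlgebra p) (IwasawaAlgebra p ⧸ Ideal.span {g}) g :=
    (Module.isTorsionBy_quotient_iff _ g).mpr fun y ↦ by
      rw [smul_eq_mul]
      exact Ideal.mul_mem_right y _ (Ideal.mem_span_singleton_self g)
  have hQ : Module.IsTorsion (IwasawaAlgebra p) (IwasawaAlgebra p ⧸ Ideal.span {g}) :=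
    fun x ↦ ⟨⟨g, mem_nonZeroDivisors_of_ne_zero hg0⟩, @hby x⟩
  have hcharQ : charIdeal (IwasawaAlgebra p) (IwasawaAlgebra p ⧸ Ideal.span {g}) =
      charIdeal (IwasawaAlgebra p) M := by
    rw [charIdeal_eq_span_of_lengthAt_eq_quotient hg0 fun _ _ ↦ rfl, hchar]
  have hlen : ∀ 𝔭 : PrimeSpectrum (IwasawaAlgebra p), 𝔭.asIdeal.height = 1 →
      lengthAt (IwasawaAlgebra p) N 𝔭 ≤
        lengthAt (IwasawaAlgebra p) (IwasawaAlgebra p ⧸ Ideal.span {g}) 𝔭 := fun 𝔭 h𝔭 ↦ by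
    rw [SkinnerUrban2014.lengthAt_eq_of_charIdeal_eq hQ hM hcharQ 𝔭 h𝔭]
    exact h 𝔭 h𝔭
  have hmem : g ∈ charIdeal (IwasawaAlgebra p) N := mem_charIdeal_of_lengthAt_le hN hg0 hlen
  rw [hchar, Ideal.span_singleton_le_iff_mem]
  exact hmem

end Algebra

/-! ### Over Kato's §17.13 package with a fine quotient -/

section Package

variable {p : ℕ} [Fact p.Prime] {W : WeierstrassCurve ℚ} [W.IsElliptic] [W.IsGloballyMinimal]
  [ContinuousSMul ℤ_[p] (W.tateModule p)] {N : ℕ} [NeZero N] {f : CuspForm (Gamma0 N) 2}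
  {κ : ZpExtension ℚ p} {γ : absoluteGaloisGroup ℚ}
  {I : IwasawaH1Data W p κ γ} {D : W.SelmerDualData κ γ}
  {Y : Type u} [AddCommGroup Y] [_root_.Module (IwasawaAlgebra p) Y]

omit [NeZero N] in
/-- **`ℓ_𝔭(X₀) ≤ ℓ_𝔭(𝐇²)` at every prime**: the fine quotient `Y ≅ Ker ε` embeds in `𝐇²` ((17.13.1)
exact at `𝔛` and at `𝐇²`). [cite: Kato2004Asterisque, §17.13 (17.13.1) (p. 279)] -/
theorem lengthAt_fine_le_lengthAt_H2 (K : DivisibilityInputs W p f κ γ I D)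
    (π : D.X →ₗ[IwasawaAlgebra p] Y) (hπs : Function.Surjective π) (hπ : Function.Exact K.toX π)
    (𝔭 : PrimeSpectrum (IwasawaAlgebra p)) :
    lengthAt (IwasawaAlgebra p) Y 𝔭 ≤ lengthAt (IwasawaAlgebra p) K.H2 𝔭 := by
  rw [← lengthAt_fine_add_lengthAt_range_eq K π hπs hπ 𝔭]
  exact le_self_add

omit [NeZero N] in
/-- The fine quotient is `Λ`-TORSION (no named fact needed: `Y ≅ Ker ε ⊆ 𝐇²`, and `𝐇²` is torsion,
Thm. 12.4 (1), a field of the package) — e.g. `X₀(E/ℚ_∞)` at a good ordinary odd `p`.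
[cite: Kato2004Asterisque, Thm. 12.4 (1) (p. 221) and §17.13 (17.13.1) (p. 279)] -/
theorem isTorsion_fine_of_package (K : DivisibilityInputs W p f κ γ I D)
    (π : D.X →ₗ[IwasawaAlgebra p] Y) (hπs : Function.Surjective π) (hπ : Function.Exact K.toX π) :
    Module.IsTorsion (IwasawaAlgebra p) Y := by
  have hker : LinearMap.ker π = LinearMap.ker K.δ := by
    rw [LinearMap.exact_iff.mp hπ, LinearMap.exact_iff.mp K.exact_X]
  have eY : Y ≃ₗ[IwasawaAlgebra p] LinearMap.ker K.ε :=
    (π.quotKerEquivOfSurjective hπs).symm ≪≫ₗ Submodule.quotEquivOfEq _ _ hker ≪≫ₗ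
      K.δ.quotKerEquivRange ≪≫ₗ LinearEquiv.ofEq _ _ (LinearMap.exact_iff.mp K.exact_H2).symm
  intro y
  obtain ⟨a, ha⟩ := @K.isTorsion_H2 ((eY y : LinearMap.ker K.ε) : K.H2)
  refine ⟨a, eY.injective ?_⟩
  apply Subtype.ext
  rw [map_zero, Submonoid.smul_def, map_smul, Submodule.coe_smul, ← Submonoid.smul_def, ha]
  rfl

omit [NeZero N] in
/-- The fine quotient is finitely generated over `Λ` (no named fact needed: `Y ≅ Ker ε ⊆ 𝐇²`, `𝐇²`
finitely generated, (12.2.1), a field of the package; `Λ` is Noetherian).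
[cite: Kato2004Asterisque, (12.2.1) (p. 220) and §17.13 (17.13.1) (p. 279)] -/
theorem moduleFinite_fine_of_package (K : DivisibilityInputs W p f κ γ I D)
    (π : D.X →ₗ[IwasawaAlgebra p] Y) (hπs : Function.Surjective π) (hπ : Function.Exact K.toX π) :
    Module.Finite (IwasawaAlgebra p) Y := by
  have hker : LinearMap.ker π = LinearMap.ker K.δ := by
    rw [LinearMap.exact_iff.mp hπ, LinearMap.exact_iff.mp K.exact_X]
  have eY : Y ≃ₗ[IwasawaAlgebra p] LinearMap.ker K.ε :=
    (π.quotKerEquivOfSurjective hπs).symm ≪≫ₗ Submodule.quotEquivOfEq _ _ hker ≪≫ₗ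
      K.δ.quotKerEquivRange ≪≫ₗ LinearEquiv.ofEq _ _ (LinearMap.exact_iff.mp K.exact_H2).symm
  haveI := K.finite_H2
  haveI : IsNoetherian (IwasawaAlgebra p) K.H2 := isNoetherian_of_isNoetherianRing_of_finite _ _
  exact Module.Finite.equiv eY.symm

omit [NeZero N] in
/-- **Kim Thm. 3.18 (1) = Kato Thm. 12.5 (4) with (17.13.1), LENGTH FORM for the dual fine Selmer
group, over the package:** under tower surjectivity `ρ̄_{E,p^m}` onto for every `m` there are the
integral zeta submodule `Z' ≤ 𝐇¹_Γ(T_pW)` and `G' ∈ col(loc Z')` with `ι G' = L_p(E,T)` such that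
`ℓ_𝔭(Y) ≤ ℓ_𝔭(𝐇¹_Γ/Z')` at EVERY height-one prime `𝔭` (package field `integral` composed with
`ℓ_𝔭(Y) ≤ ℓ_𝔭(𝐇²)`). [cite: Kim2025RefinedTNC, Thm. 3.18 (1) (§3.5.3, chunk p0014:L53–L59)]
[cite: Kato2004Asterisque, Thm. 12.5 (4) (p. 222) and §17.13 (17.13.1) (p. 279)] -/
theorem exists_integralZeta_lengthAt_fine_le (K : DivisibilityInputs W p f κ γ I D)
    (htower : ∀ m : ℕ, W.HasSurjectiveModNGaloisRep (p ^ m : ℕ))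
    (π : D.X →ₗ[IwasawaAlgebra p] Y) (hπs : Function.Surjective π) (hπ : Function.Exact K.toX π) :
    ∃ (Z' : Submodule (IwasawaAlgebra p) I.H) (G' : IwasawaAlgebra p),
      G' ∈ Submodule.map (K.col ∘ₗ K.loc) Z' ∧
      iwasawaToPowerSeries p G' = padicLFunction f (unitRoot W p : ℚ_[p]) ∧
      ∀ 𝔭 : PrimeSpectrum (IwasawaAlgebra p), 𝔭.asIdeal.height = 1 →
        lengthAt (IwasawaAlgebra p) Y 𝔭 ≤ lengthAt (IwasawaAlgebra p) (I.H ⧸ Z') 𝔭 := by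
  obtain ⟨Z', G', hGZ, hG, hle⟩ := K.integral htower
  exact ⟨Z', G', hGZ, hG, fun 𝔭 h𝔭 ↦ (lengthAt_fine_le_lengthAt_H2 K π hπs hπ 𝔭).trans (hle 𝔭 h𝔭)⟩

omit [NeZero N] in
/-- **Kim Thm. 3.18 (1) AS PRINTED (ideal form), for `E` at a good ordinary odd `p` under tower
surjectivity, over the package: `char_Λ(𝐇¹_Γ(T_pW)/Z') ⊆ char_Λ(Y)`** for the integral zeta submodule
`Z'` (with `ι G' = L_p(E,T)`, `G' ∈ col(loc Z')`), `Y` the fine quotient (e.g. `X₀(E/ℚ_∞)`).  Inputs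
beyond the package: `𝐇¹_Γ` finitely generated (binder; Kato (12.2.1), supplied by `Kato2004.thm12_4`
in the instance below) and `L_p(E,T) ≠ 0` (Rohrlich; so `𝐇¹_Γ/Z'`, killed by `G' ≠ 0`, is torsion).
[cite: Kim2025RefinedTNC, Thm. 3.18 (1) (§3.5.3, chunk p0014:L53–L59)]
[cite: Kato2004Asterisque, Thm. 12.5 (4) (p. 222), §17.13 (17.13.1) (p. 279)] [cite: Washington1997, §13.2] -/
theorem exists_integralZeta_charIdeal_le_charIdeal_fine (K : DivisibilityInputs W p f κ γ I D)
    [Module.Finite (IwasawaAlgebra p) I.H]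
    (htower : ∀ m : ℕ, W.HasSurjectiveModNGaloisRep (p ^ m : ℕ))
    (hL : padicLFunction f (unitRoot W p : ℚ_[p]) ≠ 0)
    (π : D.X →ₗ[IwasawaAlgebra p] Y) (hπs : Function.Surjective π) (hπ : Function.Exact K.toX π) :
    ∃ (Z' : Submodule (IwasawaAlgebra p) I.H) (G' : IwasawaAlgebra p),
      G' ∈ Submodule.map (K.col ∘ₗ K.loc) Z' ∧
      iwasawaToPowerSeries p G' = padicLFunction f (unitRoot W p : ℚ_[p]) ∧
      charIdeal (IwasawaAlgebra p) (I.H ⧸ Z') ≤ charIdeal (IwasawaAlgebra p) Y := by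
  obtain ⟨Z', G', hGZ, hG, hle⟩ := exists_integralZeta_lengthAt_fine_le K htower π hπs hπ
  have hG0 : G' ≠ 0 := by
    rintro rfl
    exact hL (by rw [← hG, map_zero])
  haveI : Module.Finite (IwasawaAlgebra p) Y := moduleFinite_fine_of_package K π hπs hπ
  have hY : Module.IsTorsion (IwasawaAlgebra p) Y := isTorsion_fine_of_package K π hπs hπ
  have hQby : Module.IsTorsionBy (IwasawaAlgebra p) (I.H ⧸ Z') G' :=
    isTorsionBy_quotient_of_skeleton K.loc K.loc_injective K.col K.col_injective Z' hGZ
  have hQ : Module.IsTorsion (IwasawaAlgebra p) (I.H ⧸ Z') :=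
    fun x ↦ ⟨⟨G', mem_nonZeroDivisors_of_ne_zero hG0⟩, @hQby x⟩
  exact ⟨Z', G', hGZ, hG, charIdeal_le_charIdeal_of_lengthAt_le hQ hY hle⟩

end Package

/-! ### The instance on the pinned fine Selmer dual, from the two named facts by name -/

section FineSelmerDual

variable {p : ℕ} [Fact p.Prime] {W : WeierstrassCurve ℚ} [W.IsElliptic] [W.IsGloballyMinimal]
  [ContinuousSMul ℤ_[p] (W.tateModule p)] {N : ℕ} [NeZero N] {f : CuspForm (Gamma0 N) 2}
  {κ : ZpExtension ℚ p} {γ : absoluteGaloisGroup ℚ}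

/-- **Kim Thm. 3.18 (1) for `E/ℚ` at a good ordinary odd `p` with `ρ̄_{E,p^m}` onto for all `m`,
on the pinned objects, MODULO the two named Kato facts `Kato2004.exists_divisibilityInputs_fineQuotient`
(§17.13 package with the fine quotient `X ↠ X₀(E/ℚ_∞)`) and `Kato2004.thm12_4` (Thm. 12.4 (2):
`𝐇¹_Γ` finitely generated):** for the cyclotomic `κ` with topological generator `γ` in the cyclotomic
variable, the newform `f` of `W`, every `I : IwasawaH1Data W p κ γ`, `D : W.SelmerDualData κ γ` and
`Y : W.FineSelmerDualData κ γ` there are a package `K`, its integral zeta submodule `Z' ≤ I.H` with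
`ι G' = L_p(E,T)`, `G' ∈ col(loc Z')`, and **`char_Λ(I.H/Z') ⊆ char_Λ(Y.X)`** (`= Y.charIdeal`).
`L_p ≠ 0` is the tree theorem `padicLFunction_unitRoot_ne_zero` (Rohrlich).
[cite: Kim2025RefinedTNC, Thm. 3.18 (1) (§3.5.3, chunk p0014:L53–L59)]
[cite: Kato2004Asterisque, Thm. 12.4 (2) (p. 221), Thm. 12.5 (4) (p. 222), §17.13 (17.13.1) (p. 279)] -/
theorem exists_charIdeal_le_charIdeal_fineSelmerDual_of_facts
    (hfine : exists_divisibilityInputs_fineQuotient) (h12 : thm12_4) (hp : p ≠ 2)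
    (hord : IsOrdinaryAt W p) (hκ : κ.IsCyclotomic) (hγ : κ.IsTopGenerator γ)
    (hγ' : IsCyclotomicVariable p γ) (hf : IsNewformOf W f)
    (htower : ∀ m : ℕ, W.HasSurjectiveModNGaloisRep (p ^ m : ℕ))
    (I : IwasawaH1Data W p κ γ) (D : W.SelmerDualData κ γ) (Y : W.FineSelmerDualData κ γ) :
    ∃ (K : DivisibilityInputs W p f κ γ I D) (Z' : Submodule (IwasawaAlgebra p) I.H)
      (G' : IwasawaAlgebra p),
      G' ∈ Submodule.map (K.col ∘ₗ K.loc) Z' ∧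
      iwasawaToPowerSeries p G' = padicLFunction f (unitRoot W p : ℚ_[p]) ∧
      charIdeal (IwasawaAlgebra p) (I.H ⧸ Z') ≤ Y.charIdeal := by
  obtain ⟨K, π, hπs, hπ⟩ := hfine W p f κ γ hp hord hκ hγ hγ' hf I D Y
  obtain ⟨hfinH, -, -⟩ := h12 W p κ γ hκ hγ I
  haveI := hfinH
  obtain ⟨Z', G', hGZ, hG, hle⟩ := exists_integralZeta_charIdeal_le_charIdeal_fine K htower
    (padicLFunction_unitRoot_ne_zero hord hf) π hπs hπ
  exact ⟨K, Z', G', hGZ, hG, hle⟩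

end FineSelmerDual

end Literature.NumberTheory.EllipticCurves.Kim2025

end
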